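import Summits.BirchSwinnertonDyer.Rank1Residual.X11b.Three.HsiehDescentTwist
import HarnessLib

/-!
# X11b @ `p = 3`, K4″ prerequisites: the transported family and the twist relation under the
# FAMILY FORM of (VR-A)

HONEST FRAMING (cell `b2b-bsdres`, run/shared/lean/b2b/bsd-rank1-residual/, verbatim in every
file): the goal of the cell is to DELETE the COMBINATION-SHAPED residual classes of the
Birch–Swinnerton-Dyer formula for ALL analytic-rank `≤ 1` elliptic curves over `ℚ` — assembled
STRICTLY from published theorems — so that the rank-`≤ 1` remainder becomes exactly the
CONSTRUCTION-SHAPED classes, which are TYPED, NOT attempted. This is not "finishing BSD". Team N8/O2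
(X11b at `3`); K4″ (x11b3-lead GEN 9 R10-24 (1) 'successor option'), seat `b2b-bsdres-x11b3-p7`
(gen. 6). WORDING OF RECORD (H45): K4′ RE-EXPRESSES (t) ⟸ (VR_loc); K4″ would RE-EXPRESS (t) ⟸
(VR_loc restricted to the node's κ-range). The value-reciprocity relation (VR-A) for ONE `σ ∈ Aut(ℂ)`
enters below as an EXPLICIT HYPOTHESIS `hVRA`, now in FAMILY FORM (only along the powers `χ₀^j` of one
base range character); nothing discharges it here; the node `Three.HsiehDescentAt₃` is UNCHANGED; O2
OPEN / N8 CONSTRUCTION; nothing booked. THEOREMS ONLY (no definition, no named fact, no `sorry`);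
every prime `p`. The landed K4-A `transported_family` / K4-C2a `exists_twist` are UNTOUCHED; these are
the same proofs with the weaker hypothesis (the originals apply (VR-A) at exactly one line, at
`(χ₀^j, j·n₀)`).

## What this file proves

* `transported_family_of_family` — K4-A's transported family with `hVRA` in family form.
* `exists_twist_of_family` — K4-C2a's twist relation `T Ē = ι⁻¹(d)·(1+T)^a·Ē` with `hVRA` in family
  form (via `transported_family_of_family` and multr1-p1's `R1.exists_binomialSeries_mul_eq_of_values`).

References: [Hsieh2014] Thm. 1; [Weil1956] §1; [Washington1997] §5.1; OWNERS R9-29/R9-30, R10-24.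
-/

noncomputable section

open scoped NumberField
open NumberField IsDedekindDomain Field PowerSeries
open Literature.NumberTheory.GaloisRepresentations Literature.NumberTheory.EllipticCurves
open Summit.BirchSwinnertonDyer.Rank1Residual.X11b.LambdaSupply
open Summit.BirchSwinnertonDyer.Rank1Residual.X11b.Three.LambdaSupply
open Summit.BirchSwinnertonDyer.Rank1Residual.X11b.PadicComplexTransport (continuous_algEquiv)

namespace Summit.BirchSwinnertonDyer.Rank1Residual.X11b.Three.RangeTransport

variable {K : Type} [Field K] [NumberField K] {p : ℕ} [Fact p.Prime] {N : ℕ}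

/-- **The transported family of a Hsieh witness — FAMILY FORM of (VR-A)** (K4″ variant of
`transported_family`: the value-reciprocity relation is assumed ONLY along the family `(χ₀^j, j·n₀)`,
`j ≥ 1`, which is all the proof uses). Data: a witness `Q` (`p ∣ N`), a period `Ω ≠ 0`,
`τ ∈ Gal(ℚ̄_p/ℚ_p)` with continuous extension `τ̂ = T` to `ℂ_p`, `σ ∈ Aut(ℂ)` with `σι = ιτ` fixing
the complex embeddings of `K` (`K` without real places), the (VR-A) value-reciprocity relation for
`σ` with constants `c, d ≠ 0` and ideal monomial `e` (HYPOTHESIS `hVRA`), and a base range point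
`(χ₀, n₀, ψ₀)`. Conclusion, for every `j ≥ 1`, with `x = τ(ψ₀(γ))`,
`θ = ι⁻¹((p/16A²)(Ω/Ω_K)⁴)Ω_p⁴`, `B'ⱼ = ι⁻¹(bdpIV(^σ(χ₀^j), j n₀, Ω))`,
`b = (ι⁻¹c · τ̂θ · θ⁻¹)^{n₀} · ι⁻¹(∏_v σ(χ₀(ϖ_v))^{e_v})`:
(i) `Q(x^j − 1) = ι⁻¹C · θ^{j n₀} · B'ⱼ` (the conjugate `^σ(χ₀^j)` is a range point with avatar
`τ ∘ ψ₀^j`); (ii) `τ̂(Q(ψ₀(γ)^j − 1)) = τ̂(ι⁻¹C) · ι⁻¹d · bʲ · (θ^{j n₀} · B'ⱼ)`; (iii) `τ̂` moves the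
point: `τ̂(ψ₀(γ)^j − 1) = x^j − 1`. [cite: Weil1956, §1] [cite: Hsieh2014, Thm. 1 (p. 4)] -/
theorem transported_family_of_family (ι : PadicAlgCl p ≃+* ℂ) {𝔭 : HeightOneSpectrum (𝓞 K)}
    {κ : ZpExtension K p} {γ : absoluteGaloisGroup K} {f : CuspForm (CongruenceSubgroup.Gamma0 N) 2}
    {A : ℝ} {ΩK C : ℂ} {Ωp : ℂ_[p]} {Q : PowerSeries 𝓞_ℂ_[p]}
    (hQ : IsHsiehLFunction ι 𝔭 κ γ f A ΩK C Ωp Q) (hpN : p ∣ N) {Ω : ℂ} (hΩ : Ω ≠ 0)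
    (hθ : (((ι.symm (((p : ℂ) / (16 * (A : ℂ) ^ 2)) * (Ω / ΩK) ^ 4) : PadicAlgCl p) : ℂ_[p]) * Ωp ^ 4) ≠ 0)
    (hK : ∀ w : InfinitePlace K, ¬ w.IsReal)
    {τ : PadicAlgCl p ≃ₐ[ℚ_[p]] PadicAlgCl p} {T : ℂ_[p] →+* ℂ_[p]}
    (hTτ : ∀ x : PadicAlgCl p, T x = τ x) {σ : ℂ ≃ₐ[ℚ] ℂ}
    (hστ : ∀ z : PadicAlgCl p, σ (ι z) = ι (τ z)) (hσK : ∀ (φ : K →+* ℂ) (k : K), σ (φ k) = φ k)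
    {c d : ℂ} {e : HeightOneSpectrum (𝓞 K) →₀ ℤ}
    {χ₀ : HeckeCharacter K} {n₀ : ℕ} (hn₀ : 0 < n₀)
    (hunr₀ : ∀ v : HeightOneSpectrum (𝓞 K), χ₀.IsUnramifiedAt v)
    (hχ₀ : χ₀.HasInfinityType (fun _ ↦ (n₀ : ℤ)) (fun _ ↦ -(n₀ : ℤ)))
    (hVRA : ∀ j : ℕ, 0 < j →
      σ (bdpInterpolationValue p f 𝔭 (χ₀ ^ j) (j * n₀) Ω) =
        d * c ^ (j * n₀) *
          (e.prod fun v k ↦ ((hasInfinityType_pow_range hχ₀ j).autConj σ).valueAtUniformizer v ^ k) *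
          bdpInterpolationValue p f 𝔭 ((hasInfinityType_pow_range hχ₀ j).autConj σ) (j * n₀) Ω)
    {ψ₀ : absoluteGaloisGroup K →ₜ* (PadicAlgCl p)ˣ}
    (hav₀ : IsPAdicAvatarOf ι χ₀ ((FramedRep.unitsContinuousMulEquivOfUnique (Fin 1) (PadicAlgCl p) :
      (PadicAlgCl p)ˣ →ₜ* GL (Fin 1) (PadicAlgCl p)).comp ψ₀))
    (hfac₀ : FactorsThroughZp κ ((FramedRep.unitsContinuousMulEquivOfUnique (Fin 1) (PadicAlgCl p) :
      (PadicAlgCl p)ˣ →ₜ* GL (Fin 1) (PadicAlgCl p)).comp ψ₀))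
    {j : ℕ} (hj : 0 < j) :
    IntSeries.HasValueAt Q (((τ ((ψ₀ γ : (PadicAlgCl p)ˣ) : PadicAlgCl p) : PadicAlgCl p) : ℂ_[p]) ^ j - 1)
        (((ι.symm C : PadicAlgCl p) : ℂ_[p]) *
          (((ι.symm (((p : ℂ) / (16 * (A : ℂ) ^ 2)) * (Ω / ΩK) ^ 4) : PadicAlgCl p) : ℂ_[p]) * Ωp ^ 4) ^ (j * n₀) *
          ((ι.symm (bdpInterpolationValue p f 𝔭 ((hasInfinityType_pow_range hχ₀ j).autConj σ)
              (j * n₀) Ω) : PadicAlgCl p) : ℂ_[p])) ∧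
      T (((ι.symm C : PadicAlgCl p) : ℂ_[p]) *
          (((ι.symm (((p : ℂ) / (16 * (A : ℂ) ^ 2)) * (Ω / ΩK) ^ 4) : PadicAlgCl p) : ℂ_[p]) * Ωp ^ 4) ^ (j * n₀) *
          ((ι.symm (bdpInterpolationValue p f 𝔭 (χ₀ ^ j) (j * n₀) Ω) : PadicAlgCl p) : ℂ_[p])) =
        T ((ι.symm C : PadicAlgCl p) : ℂ_[p]) * ((ι.symm d : PadicAlgCl p) : ℂ_[p]) *
          ((((ι.symm c : PadicAlgCl p) : ℂ_[p]) *
              T (((ι.symm (((p : ℂ) / (16 * (A : ℂ) ^ 2)) * (Ω / ΩK) ^ 4) : PadicAlgCl p) : ℂ_[p]) * Ωp ^ 4) *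
              (((ι.symm (((p : ℂ) / (16 * (A : ℂ) ^ 2)) * (Ω / ΩK) ^ 4) : PadicAlgCl p) : ℂ_[p]) * Ωp ^ 4)⁻¹) ^ n₀ *
            ((ι.symm (e.prod fun v k ↦ σ (χ₀.valueAtUniformizer v) ^ k) : PadicAlgCl p) : ℂ_[p])) ^ j *
          ((((ι.symm (((p : ℂ) / (16 * (A : ℂ) ^ 2)) * (Ω / ΩK) ^ 4) : PadicAlgCl p) : ℂ_[p]) * Ωp ^ 4) ^ (j * n₀) *
            ((ι.symm (bdpInterpolationValue p f 𝔭 ((hasInfinityType_pow_range hχ₀ j).autConj σ)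
              (j * n₀) Ω) : PadicAlgCl p) : ℂ_[p])) ∧
      T ((((ψ₀ γ : (PadicAlgCl p)ˣ) : PadicAlgCl p) : ℂ_[p]) ^ j - 1) = ((τ ((ψ₀ γ : (PadicAlgCl p)ˣ) : PadicAlgCl p) : PadicAlgCl p) : ℂ_[p]) ^ j - 1 := by
  -- abbreviations
  set e₁ := (FramedRep.unitsContinuousMulEquivOfUnique (Fin 1) (PadicAlgCl p) :
    (PadicAlgCl p)ˣ →ₜ* GL (Fin 1) (PadicAlgCl p)) with he₁
  set θ : ℂ_[p] := (((ι.symm (((p : ℂ) / (16 * (A : ℂ) ^ 2)) * (Ω / ΩK) ^ 4) : PadicAlgCl p) :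
    ℂ_[p]) * Ωp ^ 4) with hθdef
  have hτc : Continuous (τ : PadicAlgCl p ≃+* PadicAlgCl p) := continuous_algEquiv τ
  set τu : (PadicAlgCl p)ˣ →ₜ* (PadicAlgCl p)ˣ :=
    ContinuousMonoidHom.mk (Units.map ((τ : PadicAlgCl p ≃+* PadicAlgCl p) :
      PadicAlgCl p →* PadicAlgCl p)) (continuous_unitsMap _ hτc) with hτu
  -- the `j`-th power of the base point is a range point
  have hjn : 0 < j * n₀ := Nat.mul_pos hj hn₀
  have hχj : (χ₀ ^ j).HasInfinityType (fun _ ↦ ((j * n₀ : ℕ) : ℤ)) (fun _ ↦ -((j * n₀ : ℕ) : ℤ)) :=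
    hasInfinityType_pow_range hχ₀ j
  have hunrj : ∀ v : HeightOneSpectrum (𝓞 K), (χ₀ ^ j).IsUnramifiedAt v :=
    fun v ↦ isUnramifiedAt_pow' (hunr₀ v) j
  have havj : IsPAdicAvatarOf ι (χ₀ ^ j) (e₁.comp (ψ₀ ^ j)) :=
    isPAdicAvatarOf_pow ι hav₀ (fun v _ ↦ hunr₀ v) j
  have hfacj : FactorsThroughZp κ (e₁.comp (ψ₀ ^ j)) := factorsThroughZp_unitsChar_pow κ hfac₀ j
  -- its Weil conjugate is a range point with avatar `τ ∘ ψ₀^j`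
  have hunr' : ∀ v : HeightOneSpectrum (𝓞 K), (hχj.autConj σ).IsUnramifiedAt v :=
    fun v ↦ (hχj.isUnramifiedAt_autConj_iff σ v).mpr (hunrj v)
  have hinf' : (hχj.autConj σ).HasInfinityType (fun _ ↦ ((j * n₀ : ℕ) : ℤ))
      (fun _ ↦ -((j * n₀ : ℕ) : ℤ)) := hasInfinityType_autConj_of_forall_apply_eq hχj σ hσK hK
  have hav' : IsPAdicAvatarOf ι (hχj.autConj σ) (e₁.comp (τu.comp (ψ₀ ^ j))) :=
    isPAdicAvatarOf_autConj_unitsChar ι _ hτc σ hστ hχj havj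
  have hfac' : FactorsThroughZp κ (e₁.comp (τu.comp (ψ₀ ^ j))) :=
    factorsThroughZp_map_unitsChar _ hτc κ hfacj
  -- the points
  have hpt' : avatarValueAt (e₁.comp (τu.comp (ψ₀ ^ j))) γ =
      ((τ ((ψ₀ γ : (PadicAlgCl p)ˣ) : PadicAlgCl p) : PadicAlgCl p) : ℂ_[p]) ^ j := by
    rw [he₁, hτu, avatarValueAt_map_unitsChar _ hτc (ψ₀ ^ j) γ, ContinuousMonoidHom.pow_apply,
      Units.val_pow_eq_pow_val]
    change ((((τ : PadicAlgCl p ≃+* PadicAlgCl p)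
      (((ψ₀ γ : (PadicAlgCl p)ˣ) : PadicAlgCl p) ^ j)) : PadicAlgCl p) : ℂ_[p]) = _
    rw [map_pow, PadicComplex.coe_eq, map_pow]
    rfl
  have hpt : avatarValueAt (e₁.comp (ψ₀ ^ j)) γ =
      (((ψ₀ γ : (PadicAlgCl p)ˣ) : PadicAlgCl p) : ℂ_[p]) ^ j := by
    rw [he₁, avatarValueAt_unitsChar_pow, avatarValueAt_unitsChar]
  refine ⟨?_, ?_, ?_⟩
  · -- (i) the value at the transported point
    have h := hasValueAt_normalForm ι hQ hpN hΩ hjn hunr' hinf' hav' hfac'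
    rwa [hpt'] at h
  · -- (ii) the transported value
    have hB : T ((ι.symm (bdpInterpolationValue p f 𝔭 (χ₀ ^ j) (j * n₀) Ω) : PadicAlgCl p) : ℂ_[p]) =
        ((ι.symm d : PadicAlgCl p) : ℂ_[p]) * ((ι.symm c : PadicAlgCl p) : ℂ_[p]) ^ (j * n₀) *
          ((ι.symm (e.prod fun v k ↦ σ (χ₀.valueAtUniformizer v) ^ k) : PadicAlgCl p) : ℂ_[p]) ^ j *
          ((ι.symm (bdpInterpolationValue p f 𝔭 (hχj.autConj σ) (j * n₀) Ω) : PadicAlgCl p) :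
            ℂ_[p]) := by
      rw [extension_coe_symm ι hTτ σ hστ, hVRA j hj,
        prod_autConj_pow_eq σ e hχ₀ j, coe_symm_mul, coe_symm_mul, coe_symm_mul, coe_symm_pow,
        coe_symm_pow]
    rw [map_mul, map_mul, map_pow, hB]
    have h1 : θ⁻¹ * θ = 1 := inv_mul_cancel₀ hθ
    calc _ = T ((ι.symm C : PadicAlgCl p) : ℂ_[p]) * ((ι.symm d : PadicAlgCl p) : ℂ_[p]) *
          (((ι.symm c : PadicAlgCl p) : ℂ_[p]) * T θ) ^ (j * n₀) *
          ((ι.symm (e.prod fun v k ↦ σ (χ₀.valueAtUniformizer v) ^ k) : PadicAlgCl p) : ℂ_[p]) ^ j *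
          ((ι.symm (bdpInterpolationValue p f 𝔭 (hχj.autConj σ) (j * n₀) Ω) : PadicAlgCl p) :
            ℂ_[p]) * (θ⁻¹ * θ) ^ (j * n₀) := by
          rw [h1, one_pow, mul_one]; ring
      _ = _ := by ring
  · -- (iii) the point moves
    rw [map_sub, map_one, map_pow, hTτ]


/-- **The twist relation of a Hsieh witness under one Galois automorphism — FAMILY FORM of (VR-A)**
(K4″ variant of `exists_twist`: (VR-A) assumed only along `(χ₀^j, j·n₀)`, `j ≥ 1`) (see the module
docstring for the data). GIVEN the (VR-A) relation `hVRA` for `σ` with constants `c, d ≠ 0` and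
monomial `e`: `T Ē = ι⁻¹(d) · (1+T)^a · Ē` for some `a ∈ ℤ_p`, where `E = ι⁻¹(C)⁻¹ Q`.
[cite: Hsieh2014, Thm. 1 (arXiv:1112.1580 p. 4)] [cite: Washington1997, §5.1] -/
theorem exists_twist_of_family (ι : PadicAlgCl p ≃+* ℂ) {𝔭 : HeightOneSpectrum (𝓞 K)}
    {κ : ZpExtension K p} {γ : absoluteGaloisGroup K} {f : CuspForm (CongruenceSubgroup.Gamma0 N) 2}
    {A : ℝ} {ΩK C : ℂ} {Ωp : ℂ_[p]} {Q : PowerSeries 𝓞_ℂ_[p]}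
    (hQ : IsHsiehLFunction ι 𝔭 κ γ f A ΩK C Ωp Q) (hpN : p ∣ N) {Ω : ℂ} (hΩ : Ω ≠ 0)
    (hθ : (((ι.symm (((p : ℂ) / (16 * (A : ℂ) ^ 2)) * (Ω / ΩK) ^ 4) : PadicAlgCl p) : ℂ_[p]) * Ωp ^ 4) ≠ 0)
    (hC : ((ι.symm C : PadicAlgCl p) : ℂ_[p]) ≠ 0)
    (hK : ∀ w : InfinitePlace K, ¬ w.IsReal)
    {τ : PadicAlgCl p ≃ₐ[ℚ_[p]] PadicAlgCl p} {T : ℂ_[p] →+* ℂ_[p]} (hT : Continuous T)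
    (hTτ : ∀ x : PadicAlgCl p, T x = τ x)
    {φ : PadicComplexInt p →+* PadicComplexInt p} (hφ : ∀ y : PadicComplexInt p, (φ y : ℂ_[p]) = T y)
    {σ : ℂ ≃ₐ[ℚ] ℂ} (hστ : ∀ z : PadicAlgCl p, σ (ι z) = ι (τ z))
    (hσK : ∀ (φ : K →+* ℂ) (k : K), σ (φ k) = φ k)
    {c d : ℂ} {e : HeightOneSpectrum (𝓞 K) →₀ ℤ} (hc : c ≠ 0) (hd : d ≠ 0)
    {χ₀ : HeckeCharacter K} {n₀ : ℕ} (hn₀ : 0 < n₀)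
    (hunr₀ : ∀ v : HeightOneSpectrum (𝓞 K), χ₀.IsUnramifiedAt v)
    (hχ₀ : χ₀.HasInfinityType (fun _ ↦ (n₀ : ℤ)) (fun _ ↦ -(n₀ : ℤ)))
    (hVRA : ∀ j : ℕ, 0 < j →
      σ (bdpInterpolationValue p f 𝔭 (χ₀ ^ j) (j * n₀) Ω) =
        d * c ^ (j * n₀) *
          (e.prod fun v k ↦ ((hasInfinityType_pow_range hχ₀ j).autConj σ).valueAtUniformizer v ^ k) *
          bdpInterpolationValue p f 𝔭 ((hasInfinityType_pow_range hχ₀ j).autConj σ) (j * n₀) Ω)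
    {ψ₀ : absoluteGaloisGroup K →ₜ* (PadicAlgCl p)ˣ}
    (hav₀ : IsPAdicAvatarOf ι χ₀ ((FramedRep.unitsContinuousMulEquivOfUnique (Fin 1) (PadicAlgCl p) :
      (PadicAlgCl p)ˣ →ₜ* GL (Fin 1) (PadicAlgCl p)).comp ψ₀))
    (hfac₀ : FactorsThroughZp κ ((FramedRep.unitsContinuousMulEquivOfUnique (Fin 1) (PadicAlgCl p) :
      (PadicAlgCl p)ˣ →ₜ* GL (Fin 1) (PadicAlgCl p)).comp ψ₀))
    (hu : ‖(((ψ₀ γ : (PadicAlgCl p)ˣ) : PadicAlgCl p) : ℂ_[p]) - 1‖ < (p : ℝ)⁻¹)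
    (hu1 : ((ψ₀ γ : (PadicAlgCl p)ˣ) : PadicAlgCl p) ≠ 1)
    {E : PowerSeries 𝓞_ℂ_[p]} (hE0 : E ≠ 0)
    (hE : ∀ k, ((coeff k E : 𝓞_ℂ_[p]) : ℂ_[p]) =
      (((ι.symm C : PadicAlgCl p) : ℂ_[p]))⁻¹ * ((coeff k Q : 𝓞_ℂ_[p]) : ℂ_[p])) :
    ∃ a : ℤ_[p], (E.map (PadicComplexInt p).subtype).map T =
      PowerSeries.C ((ι.symm d : PadicAlgCl p) : ℂ_[p]) *
        ((((binomialSeries ℤ_[p] a).map (R1.toCpInt p)) * E).map (PadicComplexInt p).subtype) := by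
  have hp : p.Prime := Fact.out
  -- abbreviations
  set e₁ := (FramedRep.unitsContinuousMulEquivOfUnique (Fin 1) (PadicAlgCl p) :
    (PadicAlgCl p)ˣ →ₜ* GL (Fin 1) (PadicAlgCl p)) with he₁
  set CC : ℂ_[p] := ((ι.symm C : PadicAlgCl p) : ℂ_[p]) with hCC
  set θ : ℂ_[p] := (((ι.symm (((p : ℂ) / (16 * (A : ℂ) ^ 2)) * (Ω / ΩK) ^ 4) : PadicAlgCl p) :
    ℂ_[p]) * Ωp ^ 4) with hθdef
  set dd : ℂ_[p] := ((ι.symm d : PadicAlgCl p) : ℂ_[p]) with hdd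
  set u : ℂ_[p] := (((ψ₀ γ : (PadicAlgCl p)ˣ) : PadicAlgCl p) : ℂ_[p]) with hudef
  set x : ℂ_[p] := ((τ ((ψ₀ γ : (PadicAlgCl p)ˣ) : PadicAlgCl p) : PadicAlgCl p) : ℂ_[p]) with hxdef
  set b : ℂ_[p] := ((((ι.symm c : PadicAlgCl p) : ℂ_[p]) * T θ * θ⁻¹) ^ n₀ *
    ((ι.symm (e.prod fun v k ↦ σ (χ₀.valueAtUniformizer v) ^ k) : PadicAlgCl p) : ℂ_[p])) with hbdef
  have hdd0 : dd ≠ 0 := by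
    rw [hdd, PadicComplex.coe_eq, map_ne_zero_iff _ (algebraMap (PadicAlgCl p) ℂ_[p]).injective,
      map_ne_zero_iff _ ι.symm.injective]; exact hd
  have hTinj : Function.Injective T := (extension_bijective hT hTτ).1
  have hb0 : b ≠ 0 := by
    refine mul_ne_zero (pow_ne_zero _ (mul_ne_zero (mul_ne_zero ?_ ?_) (inv_ne_zero hθ)))
      (coe_symm_prod_ne_zero ι σ e χ₀)
    · rw [PadicComplex.coe_eq, map_ne_zero_iff _ (algebraMap (PadicAlgCl p) ℂ_[p]).injective,
        map_ne_zero_iff _ ι.symm.injective]; exact hc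
    · exact (map_ne_zero_iff T hTinj).2 hθ
  -- the point `x = τ(u)`: `‖x − 1‖ = ‖u − 1‖ < p⁻¹`, `x ≠ 1`
  have hxu : x = T u := by rw [hxdef, hudef, hTτ]
  have hx : ‖x - 1‖ < (p : ℝ)⁻¹ := by
    rw [hxu, ← map_one T, ← map_sub, norm_extension hT hTτ]; exact hu
  have hx1 : x ≠ 1 := by
    intro h1
    rw [hxu, ← map_one T] at h1
    have h2 : u = 1 := hTinj h1
    exact hu1 ((algebraMap (PadicAlgCl p) ℂ_[p]).injective (h2.trans (map_one _).symm))
  have hp1 : (p : ℝ)⁻¹ < 1 := inv_lt_one_of_one_lt₀ (by exact_mod_cast hp.one_lt)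
  have hxlt : ‖x - 1‖ < 1 := hx.trans hp1
  have hult : ‖u - 1‖ < 1 := hu.trans hp1
  have hxj : ∀ j : ℕ, ‖x ^ j - 1‖ < 1 := fun j ↦ (R1.norm_pow_sub_one_le hxlt j).trans_lt hxlt
  have huj : ∀ j : ℕ, ‖u ^ j - 1‖ < 1 := fun j ↦ (R1.norm_pow_sub_one_le hult j).trans_lt hult
  -- E-values from Q-values
  have hEval : ∀ {y v : ℂ_[p]}, IntSeries.HasValueAt Q y v → IntSeries.HasValueAt E y (CC⁻¹ * v) :=
    fun h ↦ hasValueAt_of_coeff_eq_mul hE h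
  -- the values along the family, `j ≥ 1`
  have hfam : ∀ j : ℕ, 0 < j → ∃ V : ℂ_[p], IntSeries.HasValueAt E (x ^ j - 1) V ∧
      IntSeries.HasValueAt (E.map φ) (x ^ j - 1) (dd * b ^ j * V) := by
    intro j hj
    obtain ⟨hi, hii, hiii⟩ := transported_family_of_family ι hQ hpN hΩ hθ hK hTτ hστ hσK hn₀ hunr₀ hχ₀
      hVRA hav₀ hfac₀ hj
    -- the untransported `j`-th point is a range point
    have hjn : 0 < j * n₀ := Nat.mul_pos hj hn₀
    have hQj : IntSeries.HasValueAt Q (u ^ j - 1) (CC * θ ^ (j * n₀) *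
        ((ι.symm (bdpInterpolationValue p f 𝔭 (χ₀ ^ j) (j * n₀) Ω) : PadicAlgCl p) : ℂ_[p])) := by
      have h := hasValueAt_normalForm ι hQ hpN hΩ hjn (fun v ↦ isUnramifiedAt_pow' (hunr₀ v) j)
        (hasInfinityType_pow_range hχ₀ j) (isPAdicAvatarOf_pow ι hav₀ (fun v _ ↦ hunr₀ v) j)
        (factorsThroughZp_unitsChar_pow κ hfac₀ j)
      rwa [avatarValueAt_unitsChar_pow, avatarValueAt_unitsChar] at h
    refine ⟨CC⁻¹ * (CC * θ ^ (j * n₀) * ((ι.symm (bdpInterpolationValue p f 𝔭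
      ((hasInfinityType_pow_range hχ₀ j).autConj σ) (j * n₀) Ω) : PadicAlgCl p) : ℂ_[p])),
      hEval hi, ?_⟩
    have h2 := hasValueAt_map_extension hT hφ (hEval hQj)
    rw [hiii, map_mul, map_inv₀, hii] at h2
    simp only [← hθdef] at h2
    simp only [← hbdef, ← hCC, ← hdd] at h2
    have hTC : T CC ≠ 0 := (map_ne_zero_iff T hTinj).2 hC
    convert h2 using 1
    field_simp
  by_cases hd1 : ‖dd‖ ≤ 1
  · -- SWAP the constant onto `E`: `Q₁ = ι⁻¹(d)·E`, `Q₁' = E^τ`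
    set dₒ : 𝓞_ℂ_[p] := ⟨dd, Literature.NumberTheory.LFunctions.Dwork.mem_unitBall.2 hd1⟩ with hdₒ
    have hdₒc : ((dₒ : 𝓞_ℂ_[p]) : ℂ_[p]) = dd := rfl
    set Q₁ : PowerSeries 𝓞_ℂ_[p] := PowerSeries.C dₒ * E with hQ₁
    choose V hV using fun j ↦ intSeries_exists_hasValueAt Q₁ (hxj j)
    choose V' hV' using fun j ↦ intSeries_exists_hasValueAt (E.map φ) (hxj j)
    have hrel : ∀ j, 0 < j → V' j = b ^ j * V j := by
      intro j hj
      obtain ⟨V₀, h1, h2⟩ := hfam j hj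
      have h1' : IntSeries.HasValueAt Q₁ (x ^ j - 1) (dd * V₀) :=
        hasValueAt_of_coeff_eq_mul (fun k ↦ by rw [hQ₁, coeff_C_mul, MulMemClass.coe_mul, hdₒc]) h1
      rw [(hV' j).unique h2, (hV j).unique h1']
      ring
    obtain ⟨a, hK2⟩ := R1.exists_binomialSeries_mul_eq_of_values hx hx1 hb0 hV hV' hrel
    rcases hK2 with ⟨hQ₁0, -⟩ | hrelS
    · exfalso
      have hCd : PowerSeries.C dₒ ≠ 0 := by
        intro h0
        have : dₒ = 0 := by
          have := congrArg constantCoeff h0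
          rwa [constantCoeff_C, map_zero] at this
        exact hdd0 (by rw [← hdₒc, this]; rfl)
      exact hE0 ((mul_eq_zero.1 hQ₁0).resolve_left hCd)
    · refine ⟨a, ?_⟩
      rw [← map_map_restrict hφ, hrelS, hQ₁, map_mul, map_mul, map_mul, map_C,
        ValuationSubring.subtype_apply, hdₒc]
      ring
  · -- SWAP the inverse constant onto `E^τ`: `Q₁ = E`, `Q₁' = ι⁻¹(d)⁻¹·E^τ`
    have hd1' : ‖dd⁻¹‖ ≤ 1 := by
      rw [norm_inv]; exact inv_le_one_of_one_le₀ (le_of_lt (lt_of_not_ge hd1))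
    set dₒ : 𝓞_ℂ_[p] := ⟨dd⁻¹, Literature.NumberTheory.LFunctions.Dwork.mem_unitBall.2 hd1'⟩ with hdₒ
    have hdₒc : ((dₒ : 𝓞_ℂ_[p]) : ℂ_[p]) = dd⁻¹ := rfl
    set Q₁' : PowerSeries 𝓞_ℂ_[p] := PowerSeries.C dₒ * E.map φ with hQ₁'
    choose V hV using fun j ↦ intSeries_exists_hasValueAt E (hxj j)
    choose V' hV' using fun j ↦ intSeries_exists_hasValueAt Q₁' (hxj j)
    have hrel : ∀ j, 0 < j → V' j = b ^ j * V j := by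
      intro j hj
      obtain ⟨V₀, h1, h2⟩ := hfam j hj
      have h2' : IntSeries.HasValueAt Q₁' (x ^ j - 1) (dd⁻¹ * (dd * b ^ j * V₀)) :=
        hasValueAt_of_coeff_eq_mul (fun k ↦ by rw [hQ₁', coeff_C_mul, MulMemClass.coe_mul, hdₒc]) h2
      rw [(hV' j).unique h2', (hV j).unique h1]
      field_simp
    obtain ⟨a, hK2⟩ := R1.exists_binomialSeries_mul_eq_of_values hx hx1 hb0 hV hV' hrel
    rcases hK2 with ⟨hQ₁0, -⟩ | hrelS
    · exact absurd hQ₁0 hE0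
    · refine ⟨a, ?_⟩
      have h3 : PowerSeries.C dd⁻¹ * (E.map (PadicComplexInt p).subtype).map T =
          (((binomialSeries ℤ_[p] a).map (R1.toCpInt p)) * E).map (PadicComplexInt p).subtype := by
        have := congrArg (PowerSeries.map (PadicComplexInt p).subtype) hrelS
        rwa [hQ₁', map_mul, map_C, ValuationSubring.subtype_apply, hdₒc, map_map_restrict hφ] at this
      rw [← h3, ← mul_assoc, ← map_mul, mul_inv_cancel₀ hdd0, map_one, one_mul]

end Summit.BirchSwinnertonDyer.Rank1Residual.X11b.Three.RangeTransport
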